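import Literature.Computability.QuantumComplexity.BQPGateSetIndependence
import Literature.Computability.Cryptography.QuantumCircuitDescFP
import Literature.Computability.Complexity.CodeFP
import HarnessLib

/-!
# Uniform substitution along a polynomial-time gate compiler

Sibling of `BQPGateSetIndependence.lean`, discharging the second of the two machine-level
hypotheses isolated there (and in `PromiseBQPGateSetIndependence.lean`) in the reduction of the
named facts `BQPOver_eq_BQP` (quantum-advantage.S26) and `PromiseBQPOver_eq_PromiseBQP`
(gate-set independence of `BQP` / `PromiseBQP`):

* **`GateCompiler.uniformSubst_of_polyTime`** — for a finite source alphabet, every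
  polynomial-time gate compiler `W : GateCompiler G₁ G₂` (`W.PolyTime`: the word sequences
  `1ᵏ ↦ word k g` are polynomial-time computable) satisfies `W.UniformSubst`: substituting the
  circuits of a polynomial-time uniform family gate by gate along `W` (`substFamily W t F`,
  accuracy level `size + t`) yields a polynomial-time uniform family. This is exactly the binder
  shape of the hypothesis `hSUB` of `BQPOver_eq_BQP_of` / `PromiseBQPOver_eq_PromiseBQP_of`, which
  therefore now only wait for the effective Solovay–Kitaev compiler (`hSK`).

The printed argument is one sentence — the describing machine of the compiled family runs the
describing machine of the original family and "replace[s] any computation using `T` arbitrary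
elementary matrices by a computation using only" the universal gates (Arora–Barak 2009, §10.3.8
with Exercise 10.8 and Def. 10.9; Watrous 2009, Def. 2; Nielsen–Chuang 2010, §4.5.5: uniformity =
"a Turing machine capable of efficiently outputting a description of the circuit"). Its content
in the tree's model (`QCircuitFamily.IsUniform` = the description `1ⁿ ↦ sigmaEncode ⟨n, m, Cₙ⟩` is
`TM2`-computable in polynomial time) is a string transducer, assembled here from the typed
polynomial-time algebra `CodeFP` (`Complexity/CodeFP.lean`) rather than from a hand-built machine:

* **Raw descriptions.** `RawGate = Bool × ℕ × List ℕ` (tag, numeral, wires) with the code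
  `RawGate.E` reproducing `QGate.encode` (`QGate.encode_eq_E_toRaw`), `RawDesc = ℕ × ℕ × List RawGate`
  with `RawDesc.E` reproducing `sigmaEncode` (`QCircuitFamily.descFn_eq_E_rawDesc`); the accessors
  and the constructor of raw gates are computed on codes (`RawGate.codeFP_tag/body/mk`).
* **The substitution as a map of raw descriptions** (`substRawDesc`): the word table of level
  `|gates| + t` (`GateCompiler.wordTable`, indexed by symbol codes), per gate a table lookup and the
  relabelling of the word's wires (`relabelWire N ws j = ws[j]` for a gate wire, `N + (j - |ws|)` for
  a scratch wire — the value of `extEmb`, `val_extEmb`), flattening, and the header `m ↦ m + scratch`;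
  **`rawDesc_substFamily`**: this IS the raw description of `substFamily W t F`.
* **The map is computed on codes** (`codeFP_substRawDesc`, from `codeFP_relabelWire`,
  `codeFP_relabelRaw`, `codeFP_substRawGate` by the `CodeFP` combinators `map`, `flatten`, `rawGetD`,
  `ite`, `natAdd/natSub/natLt`, …), the word table being computed on codes from the unary level for
  a polynomial-time compiler (`GateCompiler.codeFP_wordTable`, the word machines composed with the
  unary normaliser); hence `descFn (substFamily W t F) = S ∘ descFn F` with `S ∈ FP`
  (`GateCompiler.isUniform_substFamily`, via `QCircuitFamily.isUniform_iff_descFn_mem_FP`).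

No named facts are introduced; oracle gates are carried along unchanged, so oracle-freeness is
not needed.

## References

* S. Arora, B. Barak, *Computational Complexity: A Modern Approach*, CUP 2009, §1.3 (closure of
  polynomial time under composition and bounded loops), §6.1–6.2 (descriptions of circuits,
  `P`-uniform families), Def. 10.9, §10.3.8, Exercise 10.8 [AroraBarak2009].
* J. Watrous, *Quantum computational complexity*, arXiv:0804.3401 (2009), Def. 2, §III.2
  [Watrous2009].
* M. A. Nielsen, I. L. Chuang, *Quantum Computation and Quantum Information*, CUP 2010, §4.5.3,
  §4.5.5 [NielsenChuang2010].
* E. Bernstein, U. Vazirani, *Quantum complexity theory*, SIAM J. Comput. 26 (1997), §8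
  [BernsteinVazirani1997].
-/

noncomputable section

namespace Literature.Computability.QuantumComplexity

open _root_.Computability Complexity Complexity.Brick Cryptography

/-! ### Raw gate codes -/

/-- A **raw gate**: the data written in the description of a placed gate — a tag bit (`true` for
an oracle query), a numeral (the code of the gate symbol, resp. the number of query wires) and the
list of wire indices. [cite: AroraBarak2009, §6.1 (descriptions of circuits)] -/
abbrev RawGate : Type := Bool × (ℕ × List ℕ)

namespace RawGate

open CodeFP

/-- The code of a raw gate: the tag bit, then the pair of the binary numeral and the headed list
of binary wire indices (the format of `QGate.encode`). [cite: AroraBarak2009, §6.1] -/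
def E : RawGate → List Bool := fun γ => γ.1 :: pairE natE (listE natE) γ.2

/-- Unfolding of the raw gate code. [folklore] -/
@[simp] theorem E_apply (b : Bool) (c : ℕ) (ws : List ℕ) :
    E (b, c, ws) = b :: boolPair (natE c) (listE natE ws) := rfl

/-- The tag bit of a raw gate is computed on codes. [folklore] -/
theorem codeFP_tag : CodeFP E bitE (fun γ : RawGate => γ.1) :=
  ⟨HashBricks.headBitFn, HashBricks.headBitFn_mem_FP, fun γ => by
    obtain ⟨b, c, ws⟩ := γ
    simp [bitE]⟩

/-- The body (numeral, wires) of a raw gate is computed on codes. [folklore] -/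
theorem codeFP_body : CodeFP E (pairE natE (listE natE)) (fun γ : RawGate => γ.2) :=
  ⟨List.tail, PRelSigma.tail_mem_FP, fun γ => by
    obtain ⟨b, c, ws⟩ := γ
    rfl⟩

/-- Assembling a raw gate from its tag and body is computed on codes. [folklore] -/
theorem codeFP_mk : CodeFP (pairE bitE (pairE natE (listE natE))) E (fun p : Bool × (ℕ × List ℕ) => p) := by
  refine ⟨iteFn (HashBricks.headBitFn ∘ fstF) (List.cons true ∘ sndF) (List.cons false ∘ sndF),
    iteFn_mem_FP (comp_mem_FP HashBricks.headBitFn_mem_FP fstF_mem_FP)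
      (comp_mem_FP (cons_mem_FP true) sndF_mem_FP) (comp_mem_FP (cons_mem_FP false) sndF_mem_FP),
    fun p => ?_⟩
  obtain ⟨b, c, ws⟩ := p
  have hc : (HashBricks.headBitFn ∘ fstF) (pairE bitE (pairE natE (listE natE)) (b, c, ws)) = [b] := by
    simp [bitE]
  rw [iteFn_apply hc]
  cases b <;> simp

end RawGate

/-! ### Raw descriptions of gates, circuits and families -/

end Literature.Computability.QuantumComplexity

namespace Literature.Computability.Cryptography

open _root_.Computability Complexity QuantumComplexity

section Raw

variable {G : QGateSet} [Encodable G.Op] {n : ℕ}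

/-- The raw gate of a placed gate. [folklore] -/
def QGate.toRaw : QGate G n → RawGate
  | .gate g e => (false, Encodable.encode g, List.ofFn fun i => (e i : ℕ))
  | .oracle k e => (true, k, List.ofFn fun i => (e i : ℕ))

/-- The raw gate list of a circuit. [folklore] -/
def QCircuit.rawGates (C : QCircuit G n) : List RawGate := C.gates.map QGate.toRaw

/-- The code of a placed gate is the code of its raw gate. [folklore] -/
theorem QGate.encode_eq_E_toRaw (γ : QGate G n) : γ.encode = RawGate.E γ.toRaw := by
  have hl : (encodingListNatBool.encode : List ℕ → List Bool) = CodeFP.listE CodeFP.natE :=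
    CodeFP.listE_eq encodingNatBool
  cases γ with
  | gate g e => simp only [QGate.encode, hl]; rfl
  | oracle k e => simp only [QGate.encode, hl]; rfl

/-- The code of a circuit is the raw-list code of its raw gates. [folklore] -/
theorem QCircuit.encode_eq_rawE (C : QCircuit G n) : C.encode = CodeFP.rawE RawGate.E C.rawGates := by
  rw [QCircuit.encode_eq_encList, QCircuit.rawGates, CodeFP.rawE, List.map_map]
  congr 1
  exact List.map_congr_left fun γ _ => QGate.encode_eq_E_toRaw γ

/-- The number of raw gates is the size. [folklore] -/
@[simp] theorem QCircuit.length_rawGates (C : QCircuit G n) : C.rawGates.length = C.size := by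
  simp [QCircuit.rawGates, QCircuit.size]

end Raw

end Literature.Computability.Cryptography

namespace Literature.Computability.QuantumComplexity

open _root_.Computability Complexity Complexity.Brick Cryptography

section RawFamilies

variable {G : QGateSet} [Encodable G.Op] {n : ℕ}

/-- A **raw description**: number of inputs, number of ancillas, raw gate list. [folklore] -/
abbrev RawDesc : Type := ℕ × (ℕ × List RawGate)

/-- The code of a raw description (the format of `QCircuit.sigmaEncode`: binary input count,
unary ancilla count, raw list of gate codes). [cite: AroraBarak2009, §6.1] -/
abbrev RawDesc.E : RawDesc → List Bool :=
  CodeFP.pairE CodeFP.natE (CodeFP.pairE CodeFP.unE (CodeFP.rawE RawGate.E))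

/-- The raw description of the `n`-th circuit of a family. [folklore] -/
def _root_.Literature.Computability.Cryptography.QCircuitFamily.rawDesc (F : QCircuitFamily G) (n : ℕ) :
    RawDesc :=
  (n, F.ancillas n, (F.circ n).rawGates)

/-- The description function of a family writes the code of the raw description. [folklore] -/
theorem _root_.Literature.Computability.Cryptography.QCircuitFamily.descFn_eq_E_rawDesc
    (F : QCircuitFamily G) (z : List Bool) : F.descFn z = RawDesc.E (F.rawDesc z.length) := by
  rw [QCircuitFamily.descFn_eq, QCircuit.encode_eq_rawE]
  rfl

end RawFamilies

/-! ### Raw substitution -/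

section RawSubst

/-- **Relabelling of a word wire.** A word compiling a gate placed on the wires `ws` (of an
`N`-wire register) acts on `|ws|` gate wires followed by scratch wires; its wire `j` goes to
`ws[j]` if `j < |ws|` and to the `(j - |ws|)`-th wire of the scratch block `N, N+1, …` otherwise
(the value of `extEmb`, `val_extEmb`). [folklore] -/
def relabelWire (N : ℕ) (ws : List ℕ) (j : ℕ) : ℕ :=
  if j < ws.length then ws.getD j 0 else N + (j - ws.length)

/-- Relabelling all wires of a raw word gate. [folklore] -/
def relabelRaw (N : ℕ) (ws : List ℕ) (δ : RawGate) : RawGate :=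
  (δ.1, (δ.2.1, δ.2.2.map (relabelWire N ws)))

/-- **Substitution of one raw gate** along a word table `T` (entry `c` = raw gates of the word
compiling the symbol of code `c`): an oracle query is kept, a gate symbol of code `c` on the
wires `ws` becomes the relabelled word `T[c]`. [cite: NielsenChuang2010, §4.5.3] -/
def substRawGate (N : ℕ) (T : List (List RawGate)) (γ : RawGate) : List RawGate :=
  if γ.1 then [γ] else (T.getD γ.2.1 []).map (relabelRaw N γ.2.2)

/-- **Substitution of a raw description** `(n, m, gates)`: the scratch block is appended to the
ancillas and every gate is substituted along the word table of accuracy level `|gates| + t`.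
[cite: NielsenChuang2010, §4.5.3] -/
def substRawDesc (scratch t : ℕ) (table : ℕ → List (List RawGate)) (D : RawDesc) : RawDesc :=
  (D.1, (D.2.1 + scratch,
    (D.2.2.map (substRawGate (D.1 + D.2.1) (table (D.2.2.length + t)))).flatten))

variable {G₁ G₂ : QGateSet} [Encodable G₁.Op] [Encodable G₂.Op] (W : GateCompiler G₁ G₂)

/-- Entry `c` of the word table of level `k`: the raw gates of the word compiling the symbol of
code `c` (empty if `c` is not a code). [folklore] -/
def GateCompiler.tableEntry (k c : ℕ) : List RawGate :=
  (Encodable.decode (α := G₁.Op) c).elim [] fun g => (W.word k g).rawGates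

/-- **The word table of level `k`**, indexed by symbol codes `0, …, M`. [folklore] -/
def GateCompiler.wordTable (M k : ℕ) : List (List RawGate) :=
  (List.range (M + 1)).map (W.tableEntry k)

/-- The word table at the code of `g` holds the raw gates of the word of `g`. [folklore] -/
theorem GateCompiler.wordTable_getD {M : ℕ} (k : ℕ) {g : G₁.Op} (hg : Encodable.encode g ≤ M) :
    (W.wordTable M k).getD (Encodable.encode g) [] = (W.word k g).rawGates := by
  rw [GateCompiler.wordTable, List.getD_eq_getElem?_getD, List.getElem?_map,
    List.getElem?_range (by omega)]
  simp [GateCompiler.tableEntry, Encodable.encodek]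

variable {N : ℕ}

/-- Transport along `assocEmb` does not change raw gates (wire numbers are kept). [folklore] -/
theorem toRaw_mapWiresGate_assocEmb (n m B : ℕ) (γ : QGate G₂ (n + m + B)) :
    (mapWiresGate (assocEmb n m B) γ).toRaw = γ.toRaw := by
  cases γ with
  | gate g e => simp [mapWiresGate, QGate.toRaw, Function.Embedding.trans_apply]
  | oracle k e => simp [mapWiresGate, QGate.toRaw, Function.Embedding.trans_apply]

/-- **The value of the extended placement** is the relabelling of wires. [folklore] -/
theorem val_extEmb {a b B : ℕ} (e : Fin a ↪ Fin N) (hb : b ≤ B) (j : Fin (a + b)) :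
    (extEmb e hb j : ℕ) = relabelWire N (List.ofFn fun i => (e i : ℕ)) j := by
  induction j using Fin.addCases with
  | left i =>
    rw [extEmb_castAdd, relabelWire, if_pos (by simp)]
    rw [List.getD_eq_getElem?_getD, List.getElem?_ofFn]
    simp
  | right i =>
    rw [extEmb_natAdd, relabelWire, if_neg (by simp)]
    simp

/-- Transport of a word gate along `extEmb` is the relabelling of its raw gate. [folklore] -/
theorem toRaw_mapWiresGate_extEmb {a b B : ℕ} (e : Fin a ↪ Fin N) (hb : b ≤ B) (δ : QGate G₂ (a + b)) :
    (mapWiresGate (extEmb e hb) δ).toRaw = relabelRaw N (List.ofFn fun i => (e i : ℕ)) δ.toRaw := by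
  cases δ with
  | gate g f =>
    simp only [mapWiresGate, QGate.toRaw, relabelRaw, List.map_ofFn, Prod.mk.injEq, true_and]
    exact congrArg List.ofFn (funext fun i => val_extEmb e hb (f i))
  | oracle k f =>
    simp only [mapWiresGate, QGate.toRaw, relabelRaw, List.map_ofFn, Prod.mk.injEq, true_and]
    exact congrArg List.ofFn (funext fun i => val_extEmb e hb (f i))

/-- **Raw gates of one substituted gate.** [folklore] -/
theorem map_toRaw_substGate {M : ℕ} (hM : ∀ g : G₁.Op, Encodable.encode g ≤ M) (k : ℕ) (γ : QGate G₁ N) :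
    (substGate W k γ).map QGate.toRaw = substRawGate N (W.wordTable M k) γ.toRaw := by
  cases γ with
  | gate g e =>
    rw [substRawGate, QGate.toRaw]
    simp only [Bool.false_eq_true, ↓reduceIte]
    rw [W.wordTable_getD k (hM g), QCircuit.rawGates, List.map_map, substGate, gates_mapWires, List.map_map]
    exact List.map_congr_left fun δ _ => toRaw_mapWiresGate_extEmb e (W.extra_le g) δ
  | oracle q e =>
    rw [substRawGate, QGate.toRaw]
    simp [substGate, QGate.toRaw, Function.Embedding.trans_apply]

/-- **Raw gates of a substituted circuit.** [folklore] -/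
theorem rawGates_substCircuit {M : ℕ} (hM : ∀ g : G₁.Op, Encodable.encode g ≤ M) (k : ℕ) (C : QCircuit G₁ N) :
    (substCircuit W k C).rawGates = (C.rawGates.map (substRawGate N (W.wordTable M k))).flatten := by
  rw [QCircuit.rawGates, gates_substCircuit, List.map_flatMap, List.flatMap_def, QCircuit.rawGates,
    List.map_map]
  congr 1
  exact List.map_congr_left fun γ _ => map_toRaw_substGate W hM k γ

/-- **The raw description of the substituted family is the raw substitution of the raw
description.** [cite: NielsenChuang2010, §4.5.3] -/
theorem rawDesc_substFamily {M : ℕ} (hM : ∀ g : G₁.Op, Encodable.encode g ≤ M) (t : ℕ)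
    (F : QCircuitFamily G₁) (n : ℕ) :
    (substFamily W t F).rawDesc n = substRawDesc W.scratch t (W.wordTable M) (F.rawDesc n) := by
  simp only [QCircuitFamily.rawDesc, substRawDesc, QCircuit.length_rawGates]
  refine Prod.ext rfl (Prod.ext rfl ?_)
  change (mapWires (assocEmb n (F.ancillas n) W.scratch)
    (substCircuit W ((F.circ n).size + t) (F.circ n))).rawGates = _
  rw [← rawGates_substCircuit W hM, QCircuit.rawGates, gates_mapWires, List.map_map, QCircuit.rawGates]
  exact List.map_congr_left fun γ _ => toRaw_mapWiresGate_assocEmb n (F.ancillas n) W.scratch γ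

end RawSubst

/-! ### The substitution is computed on codes -/

section Program

open CodeFP

/-- The code of the context `(N, ws)` of a wire relabelling. [folklore] -/
private abbrev ctxWE : ℕ × List ℕ → List Bool := pairE natE (rawE natE)

/-- `natE 0 = ε`. [folklore] -/
private theorem natE_zero : natE 0 = [] := rfl

/-- **Wire relabelling is computed on codes.** [cite: AroraBarak2009, §1.3] -/
theorem codeFP_relabelWire :
    CodeFP (pairE ctxWE natE) natE (fun p : (ℕ × List ℕ) × ℕ => relabelWire p.1.1 p.1.2 p.2) := by
  have hN : CodeFP (pairE ctxWE natE) natE (fun p : (ℕ × List ℕ) × ℕ => p.1.1) := (fst _ _).fst'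
  have hws : CodeFP (pairE ctxWE natE) (rawE natE) (fun p : (ℕ × List ℕ) × ℕ => p.1.2) := (fst _ _).snd'
  have hj : CodeFP (pairE ctxWE natE) natE (fun p : (ℕ × List ℕ) × ℕ => p.2) := snd _ _
  have hlen : CodeFP (pairE ctxWE natE) natE (fun p : (ℕ × List ℕ) × ℕ => p.1.2.length) :=
    (natLength natE).comp hws
  have hcond : CodeFP (pairE ctxWE natE) bitE (fun p : (ℕ × List ℕ) × ℕ => decide (p.2 < p.1.2.length)) :=
    natLt.comp (hj.pair hlen)
  have hthen : CodeFP (pairE ctxWE natE) natE (fun p : (ℕ × List ℕ) × ℕ => p.1.2.getD p.2 0) :=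
    (rawGetD natE (d := 0) natE_zero).comp (hws.pair hj)
  have helse : CodeFP (pairE ctxWE natE) natE (fun p : (ℕ × List ℕ) × ℕ => p.1.1 + (p.2 - p.1.2.length)) :=
    natAdd.comp (hN.pair (natSub.comp (hj.pair hlen)))
  exact (hcond.ite hthen helse).congr fun p => by simp [relabelWire]

/-- **Relabelling a raw word gate is computed on codes.** [cite: AroraBarak2009, §1.3] -/
theorem codeFP_relabelRaw :
    CodeFP (pairE ctxWE RawGate.E) RawGate.E (fun p : (ℕ × List ℕ) × RawGate => relabelRaw p.1.1 p.1.2 p.2) := by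
  have hctx : CodeFP (pairE ctxWE RawGate.E) ctxWE (fun p : (ℕ × List ℕ) × RawGate => p.1) := fst _ _
  have hδ : CodeFP (pairE ctxWE RawGate.E) RawGate.E (fun p : (ℕ × List ℕ) × RawGate => p.2) := snd _ _
  have htag : CodeFP (pairE ctxWE RawGate.E) bitE (fun p : (ℕ × List ℕ) × RawGate => p.2.1) :=
    RawGate.codeFP_tag.comp hδ
  have hbody : CodeFP (pairE ctxWE RawGate.E) (pairE natE (listE natE))
      (fun p : (ℕ × List ℕ) × RawGate => p.2.2) := RawGate.codeFP_body.comp hδ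
  have hnum : CodeFP (pairE ctxWE RawGate.E) natE (fun p : (ℕ × List ℕ) × RawGate => p.2.2.1) := hbody.fst'
  have hvs : CodeFP (pairE ctxWE RawGate.E) (rawE natE) (fun p : (ℕ × List ℕ) × RawGate => p.2.2.2) :=
    (rawOfList natE).comp hbody.snd'
  have hmap : CodeFP (pairE ctxWE RawGate.E) (rawE natE)
      (fun p : (ℕ × List ℕ) × RawGate => p.2.2.2.map (relabelWire p.1.1 p.1.2)) :=
    ((map codeFP_relabelWire).comp (hctx.pair hvs)).congr fun p => rfl
  have hvs' : CodeFP (pairE ctxWE RawGate.E) (listE natE)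
      (fun p : (ℕ × List ℕ) × RawGate => p.2.2.2.map (relabelWire p.1.1 p.1.2)) :=
    (listOfRaw natE).comp hmap
  exact (RawGate.codeFP_mk.comp (htag.pair (hnum.pair hvs'))).congr fun p => rfl

/-- The code of the context `(N, T)` of a gate substitution. [folklore] -/
private abbrev ctxGE : ℕ × List (List RawGate) → List Bool := pairE natE (rawE (rawE RawGate.E))

/-- **Substituting one raw gate is computed on codes.** [cite: AroraBarak2009, §1.3] -/
theorem codeFP_substRawGate :
    CodeFP (pairE ctxGE RawGate.E) (rawE RawGate.E)
      (fun p : (ℕ × List (List RawGate)) × RawGate => substRawGate p.1.1 p.1.2 p.2) := by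
  have hN : CodeFP (pairE ctxGE RawGate.E) natE (fun p : (ℕ × List (List RawGate)) × RawGate => p.1.1) :=
    (fst _ _).fst'
  have hT : CodeFP (pairE ctxGE RawGate.E) (rawE (rawE RawGate.E))
      (fun p : (ℕ × List (List RawGate)) × RawGate => p.1.2) := (fst _ _).snd'
  have hγ : CodeFP (pairE ctxGE RawGate.E) RawGate.E (fun p : (ℕ × List (List RawGate)) × RawGate => p.2) :=
    snd _ _
  have htag : CodeFP (pairE ctxGE RawGate.E) bitE (fun p : (ℕ × List (List RawGate)) × RawGate => p.2.1) :=
    RawGate.codeFP_tag.comp hγ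
  have hbody : CodeFP (pairE ctxGE RawGate.E) (pairE natE (listE natE))
      (fun p : (ℕ × List (List RawGate)) × RawGate => p.2.2) := RawGate.codeFP_body.comp hγ
  have hc : CodeFP (pairE ctxGE RawGate.E) natE (fun p : (ℕ × List (List RawGate)) × RawGate => p.2.2.1) :=
    hbody.fst'
  have hws : CodeFP (pairE ctxGE RawGate.E) (rawE natE)
      (fun p : (ℕ × List (List RawGate)) × RawGate => p.2.2.2) := (rawOfList natE).comp hbody.snd'
  have hword : CodeFP (pairE ctxGE RawGate.E) (rawE RawGate.E)
      (fun p : (ℕ × List (List RawGate)) × RawGate => p.1.2.getD p.2.2.1 []) :=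
    (rawGetD (rawE RawGate.E) (d := []) rfl).comp (hT.pair hc)
  have hthen : CodeFP (pairE ctxGE RawGate.E) (rawE RawGate.E)
      (fun p : (ℕ × List (List RawGate)) × RawGate => [p.2]) := (rawSingleton RawGate.E).comp hγ
  have helse : CodeFP (pairE ctxGE RawGate.E) (rawE RawGate.E)
      (fun p : (ℕ × List (List RawGate)) × RawGate => (p.1.2.getD p.2.2.1 []).map (relabelRaw p.1.1 p.2.2.2)) :=
    ((map codeFP_relabelRaw).comp ((hN.pair hws).pair hword)).congr fun p => rfl
  exact (htag.ite hthen helse).congr fun p => rfl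

/-- **The raw substitution of descriptions is computed on codes**, for a word table computed on
codes from the unary accuracy level. [cite: AroraBarak2009, §1.3 and §6.2] -/
theorem codeFP_substRawDesc (scratch t : ℕ) {table : ℕ → List (List RawGate)}
    (htable : CodeFP unE (rawE (rawE RawGate.E)) table) :
    CodeFP RawDesc.E RawDesc.E (substRawDesc scratch t table) := by
  have hn : CodeFP RawDesc.E natE (fun D : RawDesc => D.1) := fst _ _
  have hm : CodeFP RawDesc.E unE (fun D : RawDesc => D.2.1) := (snd _ _).fst'
  have hgs : CodeFP RawDesc.E (rawE RawGate.E) (fun D : RawDesc => D.2.2) := (snd _ _).snd'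
  have hN : CodeFP RawDesc.E natE (fun D : RawDesc => D.1 + D.2.1) := natAdd.comp (hn.pair (natOfUn.comp hm))
  have hk : CodeFP RawDesc.E unE (fun D : RawDesc => D.2.2.length + t) :=
    unAdd.comp (((ulength RawGate.E).comp hgs).pair (const _ t))
  have hT : CodeFP RawDesc.E (rawE (rawE RawGate.E)) (fun D : RawDesc => table (D.2.2.length + t)) :=
    htable.comp hk
  have hmapped : CodeFP RawDesc.E (rawE (rawE RawGate.E))
      (fun D : RawDesc => D.2.2.map (substRawGate (D.1 + D.2.1) (table (D.2.2.length + t)))) :=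
    ((map codeFP_substRawGate).comp ((hN.pair hT).pair hgs)).congr fun D => rfl
  have hflat : CodeFP RawDesc.E (rawE RawGate.E)
      (fun D : RawDesc => (D.2.2.map (substRawGate (D.1 + D.2.1) (table (D.2.2.length + t)))).flatten) :=
    (flatten RawGate.E).comp hmapped
  have hm' : CodeFP RawDesc.E unE (fun D : RawDesc => D.2.1 + scratch) := unAdd.comp (hm.pair (const _ scratch))
  exact (hn.pair (hm'.pair hflat)).congr fun D => rfl

variable {G₁ G₂ : QGateSet} [Encodable G₁.Op] [Encodable G₂.Op] (W : GateCompiler G₁ G₂)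

omit [Encodable G₁.Op] in
/-- **The raw gates of the words of a polynomial-time compiler are computed on codes** from the
unary accuracy level (the word machine composed with the unary normaliser `z ↦ 1^{|z|}`).
[cite: AroraBarak2009, §1.3] -/
theorem GateCompiler.codeFP_word (hW : W.PolyTime) (g : G₁.Op) :
    CodeFP unE (rawE RawGate.E) (fun k => (W.word k g).rawGates) := by
  have hlen : PolyTimeComputable (_root_.id : List Bool → List Bool) unaryEncodeNat
      (List.length : List Bool → ℕ) :=
    PolyTimeComputable.of_encode (f := (List.length : List Bool → ℕ)) onesFn_mem_FP _root_.id (fun _ => rfl)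
      (fun _ => rfl)
  have hc := PolyTimeComputable.comp_holds (hW.polyTime g) hlen
  refine ⟨fun z => (W.word z.length g).encode, ?_, fun k => ?_⟩
  · exact PolyTimeComputable.of_encode (f := fun z : List Bool => (W.word z.length g).encode) hc _root_.id
      (fun _ => rfl) (fun _ => rfl)
  · simp only [unE, QCircuit.encode_eq_rawE]
    rw [show (unaryEncodeNat k).length = k from unary_decode_encode_nat k]

/-- Every entry of the word table is computed on codes. [folklore] -/
theorem GateCompiler.codeFP_tableEntry (hW : W.PolyTime) (c : ℕ) :
    CodeFP unE (rawE RawGate.E) (fun k => W.tableEntry k c) := by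
  unfold GateCompiler.tableEntry
  cases Encodable.decode (α := G₁.Op) c with
  | none => exact CodeFP.const unE []
  | some g => exact W.codeFP_word hW g

/-- A list of maps computed on codes, tabulated. [folklore] -/
theorem codeFP_map_list {β : Type} {e : β → List Bool} {f : ℕ → ℕ → β}
    (hf : ∀ c, CodeFP unE e (fun k => f k c)) (cs : List ℕ) :
    CodeFP unE (rawE e) (fun k => cs.map (f k)) := by
  induction cs with
  | nil => exact CodeFP.const unE []
  | cons c cs ih => exact ((rawCons e).comp ((hf c).pair ih)).congr fun k => rfl

/-- **The word table of a polynomial-time compiler is computed on codes.** [cite: AroraBarak2009, §1.3] -/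
theorem GateCompiler.codeFP_wordTable (hW : W.PolyTime) (M : ℕ) :
    CodeFP unE (rawE (rawE RawGate.E)) (W.wordTable M) :=
  codeFP_map_list (W.codeFP_tableEntry hW) (List.range (M + 1))

end Program

/-! ### Uniformity of substituted families -/

section Uniform

variable {G₁ G₂ : QGateSet} [Encodable G₁.Op] [Encodable G₂.Op] (W : GateCompiler G₁ G₂)

/-- **Substitution along a polynomial-time compiler preserves polynomial-time uniformity**:
the description function of `substFamily W t F` is the `FP` transducer of `codeFP_substRawDesc`
(fed by the word table of `W`) composed with the description function of `F`.
[cite: AroraBarak2009, §10.3.8 and Exercise 10.8; §6.2 and §1.3] -/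
theorem GateCompiler.isUniform_substFamily [Finite G₁.Op] (hW : W.PolyTime) (t : ℕ)
    {F : QCircuitFamily G₁} (hF : F.IsUniform) : (substFamily W t F).IsUniform := by
  obtain ⟨M, hM⟩ := (Set.finite_range fun g : G₁.Op => Encodable.encode g).bddAbove
  have hM' : ∀ g : G₁.Op, Encodable.encode g ≤ M := fun g => hM ⟨g, rfl⟩
  rw [QCircuitFamily.isUniform_iff_descFn_mem_FP] at hF ⊢
  obtain ⟨S, hS, hSe⟩ := codeFP_substRawDesc W.scratch t (W.codeFP_wordTable hW M)
  have h : (substFamily W t F).descFn = S ∘ F.descFn := funext fun z => by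
    rw [Function.comp_apply, QCircuitFamily.descFn_eq_E_rawDesc, QCircuitFamily.descFn_eq_E_rawDesc, hSe,
      rawDesc_substFamily W hM']
  rw [h]
  exact comp_mem_FP hS hF

/-- **Uniform substitution along polynomial-time compilers** (`GateCompiler.UniformSubst` of
`BQPGateSetIndependence.lean`, the hypothesis `hSUB` of `BQPOver_eq_BQP_of` and of
`PromiseBQPOver_eq_PromiseBQP_of`): for a finite source alphabet, substituted families of uniform
families along a polynomial-time gate compiler are uniform. [cite: AroraBarak2009, §10.3.8 and Exercise 10.8] -/
theorem GateCompiler.uniformSubst_of_polyTime [Finite G₁.Op] (hW : W.PolyTime) : W.UniformSubst :=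
  ⟨fun _ t _ hF => W.isUniform_substFamily hW t hF⟩

end Uniform

end Literature.Computability.QuantumComplexity

end
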